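import Summits.BirchSwinnertonDyer.Rank1Residual.X11b.Three.HsiehDescentReciprocityPrelude
import Summits.BirchSwinnertonDyer.Rank1Residual.X11b.Three.CompletedGaloisAction
import Summits.BirchSwinnertonDyer.Rank1Residual.X11b.InterpolationCharacterSupply
import HarnessLib

/-!
# X11b @ `p = 3`, S29 K4-A: values of a Hsieh witness along a Galois-transported family

HONEST FRAMING (cell `b2b-bsdres`, run/shared/lean/b2b/bsd-rank1-residual/, verbatim in every
file): the goal of the cell is to DELETE the COMBINATION-SHAPED residual classes of the
Birch–Swinnerton-Dyer formula for ALL analytic-rank `≤ 1` elliptic curves over `ℚ` — assembled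
STRICTLY from published theorems — so that the rank-`≤ 1` remainder becomes exactly the
CONSTRUCTION-SHAPED classes, which are TYPED, NOT attempted. This is not "finishing BSD". Team N8/O2
(X11b at `3`); deal S29 (x11b3-lead GEN 8, OWNERS R9-8/R9-14/R9-21/R9-29), package K4 (Step 0–1),
seat `b2b-bsdres-x11b3-p7` (gen. 5). WORDING OF RECORD (H45, R9-8): S29 RE-EXPRESSES (t) ⟸ (VR). The
value-reciprocity clause (VR-A) enters below as an EXPLICIT HYPOTHESIS `hVRA` on ONE `σ ∈ Aut(ℂ)`
(its constants `c, d` and ideal monomial `e`); nothing discharges it here; the node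
`Three.HsiehDescentAt₃` is UNCHANGED; O2 OPEN / N8 CONSTRUCTION; nothing booked. THEOREMS ONLY (no
definition, no named fact, no `sorry`); every prime `p`.

## What this file proves (plan `s25/K4-PLAN.md` Steps 0–1, `s25/K4-INTERFACES.md`)

Let `(A, Ω_K, C, Ω_p, Q)` be a Hsieh witness (`IsHsiehLFunction ι 𝔭 κ γ f A Ω_K C Ω_p Q`, `p ∣ N`)
and `Ω ≠ 0` a complex period. Put `C̃ = ι⁻¹C`, `θ = ι⁻¹((p/16A²)(Ω/Ω_K)⁴)·Ω_p⁴ ∈ ℂ_p` and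
`B(χ, n) = ι⁻¹(bdpInterpolationValue p f 𝔭 χ n Ω)`.
* `hasValueAt_normalForm` — NORMAL FORM: at every point of the interpolation RANGE,
  `Q(r(γ) − 1) = C̃ · θⁿ · B(χ, n)` (the witness enters through ONE `n`-th power; prelude
  `hsiehInterpolationValue_eq_mul_pow_mul`).
* `valueAtUniformizer_pow'`, `prod_autConj_pow_eq` — the ideal monomial of (VR-A) along the powers
  `χ₀^j` is the `j`-th power of that of `χ₀` (`(^σ(χ₀^j))(ϖ_v) = σ(χ₀(ϖ_v))^j`).
* `transported_family` — THE TRANSPORTED FAMILY: for `τ ∈ Gal(ℚ̄_p/ℚ_p)` with continuous extension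
  `τ̂` to `ℂ_p`, `σ ∈ Aut(ℂ)` with `σι = ιτ` fixing the embeddings of `K` (no real place), a base RANGE
  point `(χ₀, n₀, ψ₀)` and every `j ≥ 1`: Weil's conjugate `^σ(χ₀^j)` is a RANGE point with avatar
  `τ ∘ ψ₀^j` at the point `x^j − 1`, `x = τ(ψ₀(γ))`; `Q(x^j − 1) = C̃ θ^{j n₀} B'ⱼ`; and, GIVEN (VR-A) for
  `σ`, `τ̂(Q(ψ₀(γ)^j − 1)) = τ̂C̃ · d̃ · bʲ · θ^{j n₀} B'ⱼ` with ONE ratio `b = (c̃·τ̂θ/θ)^{n₀}·M ≠ 0`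
  (`M = ι⁻¹` of the monomial of `χ₀`) — exactly the input shape of multr1-p1's
  `R1.exists_unit_mul_eq_of_values` ("frames tied along the powers of a principal unit", K2 of record
  R9-29) for the pair `(C̃⁻¹Q, (τ̂C̃)⁻¹·τ̂Q)` up to the constant `d̃`.

References: [Hsieh2014] Thm. 1; [Castella2018] Thm. 3.1; [Weil1956] §1; cell files OWNERS R9-8/R9-29.
-/

noncomputable section

open scoped NumberField
open NumberField IsDedekindDomain Field
open Literature.NumberTheory.GaloisRepresentations Literature.NumberTheory.EllipticCurves
open Summit.BirchSwinnertonDyer.Rank1Residual.X11b.LambdaSupply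
open Summit.BirchSwinnertonDyer.Rank1Residual.X11b.Three.LambdaSupply
open Summit.BirchSwinnertonDyer.Rank1Residual.X11b.PadicComplexTransport (continuous_algEquiv)

namespace Summit.BirchSwinnertonDyer.Rank1Residual.X11b.Three.RangeTransport

variable {K : Type} [Field K] [NumberField K] {p : ℕ} [Fact p.Prime] {N : ℕ}

/-! ### §1. The normal form of the witness values -/

/-- `ι⁻¹` read in `ℂ_p` is multiplicative (bookkeeping). [folklore] -/
theorem coe_symm_mul (ι : PadicAlgCl p ≃+* ℂ) (z w : ℂ) :
    ((ι.symm (z * w) : PadicAlgCl p) : ℂ_[p]) = ((ι.symm z : PadicAlgCl p) : ℂ_[p]) * ι.symm w := by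
  rw [map_mul, PadicComplex.coe_eq, PadicComplex.coe_eq, PadicComplex.coe_eq, map_mul]

/-- `ι⁻¹` read in `ℂ_p` commutes with powers (bookkeeping). [folklore] -/
theorem coe_symm_pow (ι : PadicAlgCl p ≃+* ℂ) (z : ℂ) (n : ℕ) :
    ((ι.symm (z ^ n) : PadicAlgCl p) : ℂ_[p]) = ((ι.symm z : PadicAlgCl p) : ℂ_[p]) ^ n := by
  rw [map_pow, PadicComplex.coe_eq, PadicComplex.coe_eq, map_pow]

/-- **Normal form of a Hsieh witness** at `p ∣ N`: at every point `(χ, n, r)` of the interpolation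
range, `Q(r(γ) − 1) = ι⁻¹C · θⁿ · ι⁻¹(bdpInterpolationValue p f 𝔭 χ n Ω)` with
`θ = ι⁻¹((p/(16A²))·(Ω/Ω_K)⁴)·Ω_p⁴`, for any complex period `Ω ≠ 0`.
[cite: Hsieh2014, Thm. 1 (arXiv:1112.1580 p. 4)] [cite: Castella2018, Thm. 3.1] -/
theorem hasValueAt_normalForm (ι : PadicAlgCl p ≃+* ℂ) {𝔭 : HeightOneSpectrum (𝓞 K)}
    {κ : ZpExtension K p} {γ : absoluteGaloisGroup K} {f : CuspForm (CongruenceSubgroup.Gamma0 N) 2}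
    {A : ℝ} {ΩK C : ℂ} {Ωp : ℂ_[p]} {Q : PowerSeries 𝓞_ℂ_[p]}
    (hQ : IsHsiehLFunction ι 𝔭 κ γ f A ΩK C Ωp Q) (hpN : p ∣ N) {Ω : ℂ} (hΩ : Ω ≠ 0)
    {χ : HeckeCharacter K} {n : ℕ} (hn : 0 < n) (hunr : ∀ v : HeightOneSpectrum (𝓞 K), χ.IsUnramifiedAt v)
    (hχ : χ.HasInfinityType (fun _ ↦ (n : ℤ)) (fun _ ↦ -(n : ℤ)))
    {r : FramedGaloisRep K (PadicAlgCl p) 1} (hr : IsPAdicAvatarOf ι χ r) (hκ : FactorsThroughZp κ r) :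
    IntSeries.HasValueAt Q (avatarValueAt r γ - 1)
      (((ι.symm C : PadicAlgCl p) : ℂ_[p]) * (((ι.symm (((p : ℂ) / (16 * (A : ℂ) ^ 2)) * (Ω / ΩK) ^ 4) : PadicAlgCl p) : ℂ_[p]) * Ωp ^ 4) ^ n *
        ((ι.symm (bdpInterpolationValue p f 𝔭 χ n Ω) : PadicAlgCl p) : ℂ_[p])) := by
  have h := hQ χ n hn hunr hχ r hr hκ
  rw [hsiehInterpolationValue_eq_mul_pow_mul hpN f 𝔭 χ n A ΩK C hΩ, coe_symm_mul, coe_symm_mul,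
    coe_symm_pow] at h
  have key : ((ι.symm C : PadicAlgCl p) : ℂ_[p]) * (((ι.symm (((p : ℂ) / (16 * (A : ℂ) ^ 2)) * (Ω / ΩK) ^ 4) : PadicAlgCl p) : ℂ_[p]) * Ωp ^ 4) ^ n *
        ((ι.symm (bdpInterpolationValue p f 𝔭 χ n Ω) : PadicAlgCl p) : ℂ_[p]) =
      ((ι.symm C : PadicAlgCl p) : ℂ_[p]) *
        ((ι.symm (((p : ℂ) / (16 * (A : ℂ) ^ 2)) * (Ω / ΩK) ^ 4) : PadicAlgCl p) : ℂ_[p]) ^ n *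
        ((ι.symm (bdpInterpolationValue p f 𝔭 χ n Ω) : PadicAlgCl p) : ℂ_[p]) * Ωp ^ (4 * n) := by
    ring
  rwa [key]

/-! ### §2. The ideal monomial along powers -/

/-- Values at uniformisers of a natural power. [folklore] -/
theorem valueAtUniformizer_pow' (χ : HeckeCharacter K) (v : HeightOneSpectrum (𝓞 K)) (j : ℕ) :
    (χ ^ j).valueAtUniformizer v = χ.valueAtUniformizer v ^ j := by
  induction j with
  | zero => rw [pow_zero, pow_zero, valueAtUniformizer_one']
  | succ j ih => rw [pow_succ, pow_succ, HeckeCharacter.valueAtUniformizer_mul', ih]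

/-- Infinity type of `χ^j` in the shape `(j n, −(j n))` used by the interpolation range. [folklore] -/
theorem hasInfinityType_pow_range {χ : HeckeCharacter K} {n : ℕ}
    (hχ : χ.HasInfinityType (fun _ ↦ (n : ℤ)) (fun _ ↦ -(n : ℤ))) (j : ℕ) :
    (χ ^ j).HasInfinityType (fun _ ↦ ((j * n : ℕ) : ℤ)) (fun _ ↦ -((j * n : ℕ) : ℤ)) := by
  have h := HasInfinityType.pow_nat hχ j
  convert h using 2 <;> push_cast <;> ring_nf

/-- **The (VR-A) monomial along powers**: for `σ` and the ideal-exponent vector `e`,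
`∏_v (^σ(χ₀^j))(ϖ_v)^{e_v} = (∏_v σ(χ₀(ϖ_v))^{e_v})^j`. [cite: Weil1956, §1] -/
theorem prod_autConj_pow_eq (σ : ℂ ≃ₐ[ℚ] ℂ) (e : HeightOneSpectrum (𝓞 K) →₀ ℤ)
    {χ₀ : HeckeCharacter K} {n₀ : ℕ}
    (hχ₀ : χ₀.HasInfinityType (fun _ ↦ (n₀ : ℤ)) (fun _ ↦ -(n₀ : ℤ))) (j : ℕ) :
    (e.prod fun v k ↦ ((hasInfinityType_pow_range hχ₀ j).autConj σ).valueAtUniformizer v ^ k) =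
      (e.prod fun v k ↦ σ (χ₀.valueAtUniformizer v) ^ k) ^ j := by
  rw [Finsupp.prod, Finsupp.prod, ← Finset.prod_pow]
  refine Finset.prod_congr rfl fun v _ ↦ ?_
  rw [(hasInfinityType_pow_range hχ₀ j).valueAtUniformizer_autConj σ v, valueAtUniformizer_pow',
    map_pow, ← zpow_natCast, ← zpow_natCast, ← zpow_mul, ← zpow_mul, mul_comm]

/-! ### §3. The transported family -/

/-- `ι⁻¹ ∘ σ = τ ∘ ι⁻¹` read in `ℂ_p` through the continuous extension `τ̂`: for `z ∈ ℂ`,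
`τ̂(ι⁻¹ z) = ι⁻¹(σ z)`. [folklore] -/
theorem extension_coe_symm (ι : PadicAlgCl p ≃+* ℂ) {τ : PadicAlgCl p ≃ₐ[ℚ_[p]] PadicAlgCl p}
    {T : ℂ_[p] →+* ℂ_[p]} (hTτ : ∀ x : PadicAlgCl p, T x = τ x) (σ : ℂ ≃ₐ[ℚ] ℂ)
    (hστ : ∀ z : PadicAlgCl p, σ (ι z) = ι (τ z)) (z : ℂ) :
    T ((ι.symm z : PadicAlgCl p) : ℂ_[p]) = ((ι.symm (σ z) : PadicAlgCl p) : ℂ_[p]) := by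
  rw [hTτ, symm_apply_eq_of_transport ι (τ : PadicAlgCl p ≃+* PadicAlgCl p) σ hστ]
  rfl

/-- **The transported family of a Hsieh witness.** Data: a witness `Q` (`p ∣ N`), a period `Ω ≠ 0`,
`τ ∈ Gal(ℚ̄_p/ℚ_p)` with continuous extension `τ̂ = T` to `ℂ_p`, `σ ∈ Aut(ℂ)` with `σι = ιτ` fixing
the complex embeddings of `K` (`K` without real places), the (VR-A) value-reciprocity relation for
`σ` with constants `c, d ≠ 0` and ideal monomial `e` (HYPOTHESIS `hVRA`), and a base range point
`(χ₀, n₀, ψ₀)`. Conclusion, for every `j ≥ 1`, with `x = τ(ψ₀(γ))`,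
`θ = ι⁻¹((p/16A²)(Ω/Ω_K)⁴)Ω_p⁴`, `B'ⱼ = ι⁻¹(bdpIV(^σ(χ₀^j), j n₀, Ω))`,
`b = (ι⁻¹c · τ̂θ · θ⁻¹)^{n₀} · ι⁻¹(∏_v σ(χ₀(ϖ_v))^{e_v})`:
(i) `Q(x^j − 1) = ι⁻¹C · θ^{j n₀} · B'ⱼ` (the conjugate `^σ(χ₀^j)` is a range point with avatar
`τ ∘ ψ₀^j`); (ii) `τ̂(Q(ψ₀(γ)^j − 1)) = τ̂(ι⁻¹C) · ι⁻¹d · bʲ · (θ^{j n₀} · B'ⱼ)`; (iii) `τ̂` moves the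
point: `τ̂(ψ₀(γ)^j − 1) = x^j − 1`. [cite: Weil1956, §1] [cite: Hsieh2014, Thm. 1 (p. 4)] -/
theorem transported_family (ι : PadicAlgCl p ≃+* ℂ) {𝔭 : HeightOneSpectrum (𝓞 K)}
    {κ : ZpExtension K p} {γ : absoluteGaloisGroup K} {f : CuspForm (CongruenceSubgroup.Gamma0 N) 2}
    {A : ℝ} {ΩK C : ℂ} {Ωp : ℂ_[p]} {Q : PowerSeries 𝓞_ℂ_[p]}
    (hQ : IsHsiehLFunction ι 𝔭 κ γ f A ΩK C Ωp Q) (hpN : p ∣ N) {Ω : ℂ} (hΩ : Ω ≠ 0)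
    (hθ : (((ι.symm (((p : ℂ) / (16 * (A : ℂ) ^ 2)) * (Ω / ΩK) ^ 4) : PadicAlgCl p) : ℂ_[p]) * Ωp ^ 4) ≠ 0)
    (hK : ∀ w : InfinitePlace K, ¬ w.IsReal)
    {τ : PadicAlgCl p ≃ₐ[ℚ_[p]] PadicAlgCl p} {T : ℂ_[p] →+* ℂ_[p]}
    (hTτ : ∀ x : PadicAlgCl p, T x = τ x) {σ : ℂ ≃ₐ[ℚ] ℂ}
    (hστ : ∀ z : PadicAlgCl p, σ (ι z) = ι (τ z)) (hσK : ∀ (φ : K →+* ℂ) (k : K), σ (φ k) = φ k)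
    {c d : ℂ} {e : HeightOneSpectrum (𝓞 K) →₀ ℤ}
    (hVRA : ∀ (χ : HeckeCharacter K) (n : ℕ), 0 < n →
      (∀ v : HeightOneSpectrum (𝓞 K), χ.IsUnramifiedAt v) →
      ∀ hχ : χ.HasInfinityType (fun _ ↦ (n : ℤ)) (fun _ ↦ -(n : ℤ)),
        σ (bdpInterpolationValue p f 𝔭 χ n Ω) =
          d * c ^ n * (e.prod fun v k ↦ (hχ.autConj σ).valueAtUniformizer v ^ k) *
            bdpInterpolationValue p f 𝔭 (hχ.autConj σ) n Ω)
    {χ₀ : HeckeCharacter K} {n₀ : ℕ} (hn₀ : 0 < n₀)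
    (hunr₀ : ∀ v : HeightOneSpectrum (𝓞 K), χ₀.IsUnramifiedAt v)
    (hχ₀ : χ₀.HasInfinityType (fun _ ↦ (n₀ : ℤ)) (fun _ ↦ -(n₀ : ℤ)))
    {ψ₀ : absoluteGaloisGroup K →ₜ* (PadicAlgCl p)ˣ}
    (hav₀ : IsPAdicAvatarOf ι χ₀ ((FramedRep.unitsContinuousMulEquivOfUnique (Fin 1) (PadicAlgCl p) :
      (PadicAlgCl p)ˣ →ₜ* GL (Fin 1) (PadicAlgCl p)).comp ψ₀))
    (hfac₀ : FactorsThroughZp κ ((FramedRep.unitsContinuousMulEquivOfUnique (Fin 1) (PadicAlgCl p) :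
      (PadicAlgCl p)ˣ →ₜ* GL (Fin 1) (PadicAlgCl p)).comp ψ₀))
    {j : ℕ} (hj : 0 < j) :
    IntSeries.HasValueAt Q (((τ ((ψ₀ γ : (PadicAlgCl p)ˣ) : PadicAlgCl p) : PadicAlgCl p) : ℂ_[p]) ^ j - 1)
        (((ι.symm C : PadicAlgCl p) : ℂ_[p]) *
          (((ι.symm (((p : ℂ) / (16 * (A : ℂ) ^ 2)) * (Ω / ΩK) ^ 4) : PadicAlgCl p) : ℂ_[p]) * Ωp ^ 4) ^ (j * n₀) *
          ((ι.symm (bdpInterpolationValue p f 𝔭 ((hasInfinityType_pow_range hχ₀ j).autConj σ)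
              (j * n₀) Ω) : PadicAlgCl p) : ℂ_[p])) ∧
      T (((ι.symm C : PadicAlgCl p) : ℂ_[p]) *
          (((ι.symm (((p : ℂ) / (16 * (A : ℂ) ^ 2)) * (Ω / ΩK) ^ 4) : PadicAlgCl p) : ℂ_[p]) * Ωp ^ 4) ^ (j * n₀) *
          ((ι.symm (bdpInterpolationValue p f 𝔭 (χ₀ ^ j) (j * n₀) Ω) : PadicAlgCl p) : ℂ_[p])) =
        T ((ι.symm C : PadicAlgCl p) : ℂ_[p]) * ((ι.symm d : PadicAlgCl p) : ℂ_[p]) *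
          ((((ι.symm c : PadicAlgCl p) : ℂ_[p]) *
              T (((ι.symm (((p : ℂ) / (16 * (A : ℂ) ^ 2)) * (Ω / ΩK) ^ 4) : PadicAlgCl p) : ℂ_[p]) * Ωp ^ 4) *
              (((ι.symm (((p : ℂ) / (16 * (A : ℂ) ^ 2)) * (Ω / ΩK) ^ 4) : PadicAlgCl p) : ℂ_[p]) * Ωp ^ 4)⁻¹) ^ n₀ *
            ((ι.symm (e.prod fun v k ↦ σ (χ₀.valueAtUniformizer v) ^ k) : PadicAlgCl p) : ℂ_[p])) ^ j *
          ((((ι.symm (((p : ℂ) / (16 * (A : ℂ) ^ 2)) * (Ω / ΩK) ^ 4) : PadicAlgCl p) : ℂ_[p]) * Ωp ^ 4) ^ (j * n₀) *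
            ((ι.symm (bdpInterpolationValue p f 𝔭 ((hasInfinityType_pow_range hχ₀ j).autConj σ)
              (j * n₀) Ω) : PadicAlgCl p) : ℂ_[p])) ∧
      T ((((ψ₀ γ : (PadicAlgCl p)ˣ) : PadicAlgCl p) : ℂ_[p]) ^ j - 1) = ((τ ((ψ₀ γ : (PadicAlgCl p)ˣ) : PadicAlgCl p) : PadicAlgCl p) : ℂ_[p]) ^ j - 1 := by
  -- abbreviations
  set e₁ := (FramedRep.unitsContinuousMulEquivOfUnique (Fin 1) (PadicAlgCl p) :
    (PadicAlgCl p)ˣ →ₜ* GL (Fin 1) (PadicAlgCl p)) with he₁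
  set θ : ℂ_[p] := (((ι.symm (((p : ℂ) / (16 * (A : ℂ) ^ 2)) * (Ω / ΩK) ^ 4) : PadicAlgCl p) :
    ℂ_[p]) * Ωp ^ 4) with hθdef
  have hτc : Continuous (τ : PadicAlgCl p ≃+* PadicAlgCl p) := continuous_algEquiv τ
  set τu : (PadicAlgCl p)ˣ →ₜ* (PadicAlgCl p)ˣ :=
    ContinuousMonoidHom.mk (Units.map ((τ : PadicAlgCl p ≃+* PadicAlgCl p) :
      PadicAlgCl p →* PadicAlgCl p)) (continuous_unitsMap _ hτc) with hτu
  -- the `j`-th power of the base point is a range point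
  have hjn : 0 < j * n₀ := Nat.mul_pos hj hn₀
  have hχj : (χ₀ ^ j).HasInfinityType (fun _ ↦ ((j * n₀ : ℕ) : ℤ)) (fun _ ↦ -((j * n₀ : ℕ) : ℤ)) :=
    hasInfinityType_pow_range hχ₀ j
  have hunrj : ∀ v : HeightOneSpectrum (𝓞 K), (χ₀ ^ j).IsUnramifiedAt v :=
    fun v ↦ isUnramifiedAt_pow' (hunr₀ v) j
  have havj : IsPAdicAvatarOf ι (χ₀ ^ j) (e₁.comp (ψ₀ ^ j)) :=
    isPAdicAvatarOf_pow ι hav₀ (fun v _ ↦ hunr₀ v) j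
  have hfacj : FactorsThroughZp κ (e₁.comp (ψ₀ ^ j)) := factorsThroughZp_unitsChar_pow κ hfac₀ j
  -- its Weil conjugate is a range point with avatar `τ ∘ ψ₀^j`
  have hunr' : ∀ v : HeightOneSpectrum (𝓞 K), (hχj.autConj σ).IsUnramifiedAt v :=
    fun v ↦ (hχj.isUnramifiedAt_autConj_iff σ v).mpr (hunrj v)
  have hinf' : (hχj.autConj σ).HasInfinityType (fun _ ↦ ((j * n₀ : ℕ) : ℤ))
      (fun _ ↦ -((j * n₀ : ℕ) : ℤ)) := hasInfinityType_autConj_of_forall_apply_eq hχj σ hσK hK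
  have hav' : IsPAdicAvatarOf ι (hχj.autConj σ) (e₁.comp (τu.comp (ψ₀ ^ j))) :=
    isPAdicAvatarOf_autConj_unitsChar ι _ hτc σ hστ hχj havj
  have hfac' : FactorsThroughZp κ (e₁.comp (τu.comp (ψ₀ ^ j))) :=
    factorsThroughZp_map_unitsChar _ hτc κ hfacj
  -- the points
  have hpt' : avatarValueAt (e₁.comp (τu.comp (ψ₀ ^ j))) γ =
      ((τ ((ψ₀ γ : (PadicAlgCl p)ˣ) : PadicAlgCl p) : PadicAlgCl p) : ℂ_[p]) ^ j := by
    rw [he₁, hτu, avatarValueAt_map_unitsChar _ hτc (ψ₀ ^ j) γ, ContinuousMonoidHom.pow_apply,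
      Units.val_pow_eq_pow_val]
    change ((((τ : PadicAlgCl p ≃+* PadicAlgCl p)
      (((ψ₀ γ : (PadicAlgCl p)ˣ) : PadicAlgCl p) ^ j)) : PadicAlgCl p) : ℂ_[p]) = _
    rw [map_pow, PadicComplex.coe_eq, map_pow]
    rfl
  have hpt : avatarValueAt (e₁.comp (ψ₀ ^ j)) γ =
      (((ψ₀ γ : (PadicAlgCl p)ˣ) : PadicAlgCl p) : ℂ_[p]) ^ j := by
    rw [he₁, avatarValueAt_unitsChar_pow, avatarValueAt_unitsChar]
  refine ⟨?_, ?_, ?_⟩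
  · -- (i) the value at the transported point
    have h := hasValueAt_normalForm ι hQ hpN hΩ hjn hunr' hinf' hav' hfac'
    rwa [hpt'] at h
  · -- (ii) the transported value
    have hB : T ((ι.symm (bdpInterpolationValue p f 𝔭 (χ₀ ^ j) (j * n₀) Ω) : PadicAlgCl p) : ℂ_[p]) =
        ((ι.symm d : PadicAlgCl p) : ℂ_[p]) * ((ι.symm c : PadicAlgCl p) : ℂ_[p]) ^ (j * n₀) *
          ((ι.symm (e.prod fun v k ↦ σ (χ₀.valueAtUniformizer v) ^ k) : PadicAlgCl p) : ℂ_[p]) ^ j *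
          ((ι.symm (bdpInterpolationValue p f 𝔭 (hχj.autConj σ) (j * n₀) Ω) : PadicAlgCl p) :
            ℂ_[p]) := by
      rw [extension_coe_symm ι hTτ σ hστ, hVRA (χ₀ ^ j) (j * n₀) hjn hunrj hχj,
        prod_autConj_pow_eq σ e hχ₀ j, coe_symm_mul, coe_symm_mul, coe_symm_mul, coe_symm_pow,
        coe_symm_pow]
    rw [map_mul, map_mul, map_pow, hB]
    have h1 : θ⁻¹ * θ = 1 := inv_mul_cancel₀ hθ
    calc _ = T ((ι.symm C : PadicAlgCl p) : ℂ_[p]) * ((ι.symm d : PadicAlgCl p) : ℂ_[p]) *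
          (((ι.symm c : PadicAlgCl p) : ℂ_[p]) * T θ) ^ (j * n₀) *
          ((ι.symm (e.prod fun v k ↦ σ (χ₀.valueAtUniformizer v) ^ k) : PadicAlgCl p) : ℂ_[p]) ^ j *
          ((ι.symm (bdpInterpolationValue p f 𝔭 (hχj.autConj σ) (j * n₀) Ω) : PadicAlgCl p) :
            ℂ_[p]) * (θ⁻¹ * θ) ^ (j * n₀) := by
          rw [h1, one_pow, mul_one]; ring
      _ = _ := by ring
  · -- (iii) the point moves
    rw [map_sub, map_one, map_pow, hTτ]

end Summit.BirchSwinnertonDyer.Rank1Residual.X11b.Three.RangeTransport
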